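import Summits.BirchSwinnertonDyer.Rank1Residual.X11b.UnrIntegersValuationRing
import Summits.BirchSwinnertonDyer.Rank1Residual.X11b.FramePrincipalUnitPowers
import Mathlib.Topology.MetricSpace.Contracting
import Mathlib.RingTheory.RootsOfUnity.AlgebraicallyClosed
import HarnessLib

/-!
# X11b — the UNIT GROUP of the tree's `R₀ = unrIntegers p ⊂ ℂ_p`: every unit is an algebraic unit
# times an `N`-th power (`k = k₀ · r^N`, `k₀ ∈ ℤ[μ_{p'}] ⊆ ℚ̄_p`, `r ∈ R₀ˣ`), every `p`, every `N ≥ 1`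

HONEST FRAMING (cell `b2b-bsdres`, run/shared/lean/b2b/bsd-rank1-residual/, verbatim in every
file): the goal of the cell is to DELETE the COMBINATION-SHAPED residual classes of the
Birch–Swinnerton-Dyer formula for ALL analytic-rank `≤ 1` elliptic curves over `ℚ` — "full BSD
formula for every rank `≤ 1` curve in class `C`" assembled STRICTLY from published theorems — so
that the rank-`≤ 1` remainder becomes exactly the CONSTRUCTION-SHAPED classes, which are TYPED
(missing-input `Prop`s), NOT attempted. This is not "finishing BSD". Team x11b3 (N8/O2: X11b at
`p = 3`), seat `b2b-bsdres-x11b3-p2` GEN 6, item **G6** of the S29 ledger (lead R9-36 (2); route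
planner r2's (P2)(d) / (P3)). THEOREMS ONLY (no definition, no named fact, no `sorry`); elementary
`p`-adic analysis about the Literature definition
`unrIntegers p := (Subring.closure {ζ : ℂ_p | ζ^m = 1, p ∤ m}).topologicalClosure`
("`R₀ = 𝒪(\widehat{ℚ_p^ur}) = W(𝔽̄_p)`", Castella 2018 §3); valid at EVERY prime `p`; nothing about
any curve; an unconditional kernel lemma that SUPPLIES NOTHING of the class record by itself
('S29 RE-EXPRESSES (t) ⟸ (VR)'; the node `Three.HsiehDescentAt₃` is unchanged).

## What this file proves (`𝓐 := Subring.closure {ζ : ζ^m = 1, p ∤ m}`, so `R₀ = closure 𝓐`)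

* §1 norm bookkeeping for products / powers of elements of the closed unit ball of `ℂ_p`
  (`UnrUnits.norm_pow_sub_one_le`, `UnrUnits.norm_mul_sub_one_le`,
  `UnrUnits.norm_geomSum₂_sub_natCast_le`: `Σ_{i<N} r^i r'^{N-1-i} = N + O(ρ)` on the ball
  `‖· − 1‖ ≤ ρ`).
* §2 **ROOT EXTRACTION in `R₀`** (`UnrUnits.exists_pow_eq_of_norm_sub_one_lt`): for `N ≥ 1` and
  `y ∈ R₀` with `‖y − 1‖ < ‖N‖_p²` there is `r ∈ R₀` with `r^N = y` and `‖r − 1‖ ≤ ‖y − 1‖/‖N‖_p`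
  (`< 1`). Proof: the simplified Newton map `T r = r − (r^N − y)/N` preserves the complete set
  `R₀ ∩ {‖r − 1‖ ≤ ‖y − 1‖/‖N‖_p}` (division by `N` stays in `R₀` because `R₀` is the valuation
  ring of `Frac R₀`, multr1-p1's `R1.mem_unrIntegers_of_mem_fracUnr`) and contracts it with ratio
  `‖y − 1‖/‖N‖_p² < 1` (`T r − T r' = (r − r')(N − Σ r^i r'^{N-1-i})/N`); Banach's fixed point
  theorem (Mathlib `ContractingWith.exists_fixedPoint'`) gives the root. This is Hensel's lemma for
  `X^N − y` at `1` in the complete ring `R₀`, done by hand because Mathlib's `hensels_lemma` is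
  stated for `ℤ_p` only.
* §3 **DENSITY and ALGEBRAICITY** (`UnrUnits.exists_mem_rootsSubring_norm_sub_lt`: `𝓐` is dense in
  `R₀` — the DEFINITION of `unrIntegers`; `UnrUnits.exists_coe_eq_of_pow_eq_one`,
  `UnrUnits.rootsSubring_le_range`: `𝓐 ⊆ ℚ̄_p`, i.e. every element of `𝓐` is the image of an element
  of Mathlib's `PadicAlgCl p`, because `X^m − 1` has `m` roots in the algebraically closed field
  `ℚ̄_p` and at most `m` in the field `ℂ_p`).
* §4 **UNIT STRUCTURE** (`UnrUnits.exists_algebraic_mul_pow_eq`, units-packaged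
  `UnrUnits.exists_algebraic_mul_pow`; §5 the export shapes of record
  `UnrUnits.exists_padicAlgCl_mul_unit_pow` / `…_min` = route planner r2's typed `G6Shape` /
  `G6ShapeMin` with `k₀ : PadicAlgCl p`, and x11b3-p7's consumer text T7
  `UnrUnits.forall_exists_padicAlgCl_mul_pow_of_norm_eq_one` in the unbundled `u : ℂ_p` currency): for `N ≥ 1` and `k ∈ R₀` with `‖k‖ = 1` there are
  `k₀ ∈ 𝓐` (in particular `k₀ ∈ range (PadicAlgCl p → ℂ_p)`, `‖k₀‖ = 1`) and `r ∈ R₀` with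
  `‖r − 1‖ < 1` such that `k = k₀ · r^N`: approximate `k` by `k₀ ∈ 𝓐` within `‖N‖_p²`, so that
  `y = k k₀⁻¹ ∈ R₀` (x11b3-lit1's `unrIntegers.inv_mem_of_norm_eq_one`) is a principal unit close
  enough to `1` for §2. Equivalently `R₀ˣ = (𝓐 ∩ R₀ˣ) · (R₀ˣ)^N`: the group `(R₀ˣ)^N ⊇ 1 + N²p R₀`
  is open and `𝓐` is dense.

Consumer (x11b3-p7, S29 K4 file C, period step of record = r2 (P2)): with `θ′^g = p^v · k`,
`k ∈ R₀ˣ`, write `k = k₀ · r^{4g}`; `k₀` algebraic lets the `g`-th root `β` of `p^v k₀` be taken in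
`ℚ̄_p`, and `Ω_p′ := r ∈ R₀ˣ`.

References: [SerreLocalFields1979] J.-P. Serre, *Local Fields*, Ch. II §4 Prop. 8, Ch. IV §4
Prop. 16 / Cor. 2 (`A_{K̂_nr} = W(𝔽̄_p)`, Teichmüller units), Ch. XIV §4 (powers of principal
units); [Serre1973] J.-P. Serre, *A Course in Arithmetic*, Ch. II §2.2 (Hensel / Newton), §3
(`U_n`); [Castella2018] F. Castella, Camb. J. Math. 6 (2018) §3 p. 9 (the ring `R₀`). The
statements are folklore; the proofs are self-contained over the tree's `unrIntegers`.
-/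

noncomputable section

open scoped Classical Topology NNReal
open Filter Finset Literature.NumberTheory.EllipticCurves
open Summit.BirchSwinnertonDyer.Rank1Residual.X11b.Three.LambdaSupply.PadicUnits (norm_eq_of_norm_sub_lt)

namespace Summit.BirchSwinnertonDyer.Rank1Residual.X11b

namespace UnrUnits

variable {p : ℕ} [hp : Fact p.Prime]

/-! ### §1 Norm bookkeeping in the closed unit ball of `ℂ_p` -/

/-- `‖(N : ℂ_p)‖ ≤ 1` for a natural number `N`. [folklore] -/
theorem norm_natCast_le_one (N : ℕ) : ‖(N : ℂ_[p])‖ ≤ 1 := by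
  rw [R1.norm_natCast_padicComplex]
  exact_mod_cast Padic.norm_int_le_one (N : ℤ)

/-- `0 < ‖(N : ℂ_p)‖` for `N ≠ 0`. [folklore] -/
theorem norm_natCast_pos {N : ℕ} (hN : N ≠ 0) : 0 < ‖(N : ℂ_[p])‖ :=
  norm_pos_iff.mpr (Nat.cast_ne_zero.mpr hN)

/-- For `‖x‖ ≤ 1`: `‖x^k − 1‖ ≤ ‖x − 1‖` (`x^k − 1 = (Σ_{i<k} x^i)(x − 1)` and the sum has norm
`≤ 1`). [cite: Serre1973, Ch. II §3.1] -/
theorem norm_pow_sub_one_le {x : ℂ_[p]} (hx : ‖x‖ ≤ 1) (k : ℕ) : ‖x ^ k - 1‖ ≤ ‖x - 1‖ := by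
  have h : x ^ k - 1 = (∑ i ∈ range k, x ^ i) * (x - 1) := (geom_sum_mul x k).symm
  rw [h, norm_mul]
  have hs : ‖∑ i ∈ range k, x ^ i‖ ≤ 1 :=
    IsUltrametricDist.norm_sum_le_of_forall_le_of_nonneg zero_le_one fun i _ ↦ by
      rw [norm_pow]; exact pow_le_one₀ (norm_nonneg _) hx
  calc ‖∑ i ∈ range k, x ^ i‖ * ‖x - 1‖ ≤ 1 * ‖x - 1‖ :=
        mul_le_mul_of_nonneg_right hs (norm_nonneg _)
    _ = ‖x - 1‖ := one_mul _

/-- Products stay in the ball `‖· − 1‖ ≤ ρ`: `‖a‖ ≤ 1`, `‖a − 1‖ ≤ ρ`, `‖b − 1‖ ≤ ρ` ⟹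
`‖a b − 1‖ ≤ ρ` (`a b − 1 = a (b − 1) + (a − 1)`). [folklore] -/
theorem norm_mul_sub_one_le {a b : ℂ_[p]} {ρ : ℝ} (ha : ‖a‖ ≤ 1) (ha1 : ‖a - 1‖ ≤ ρ)
    (hb1 : ‖b - 1‖ ≤ ρ) : ‖a * b - 1‖ ≤ ρ := by
  have h : a * b - 1 = a * (b - 1) + (a - 1) := by ring
  rw [h]
  refine (IsUltrametricDist.norm_add_le_max _ _).trans (max_le ?_ ha1)
  rw [norm_mul]
  calc ‖a‖ * ‖b - 1‖ ≤ 1 * ‖b - 1‖ := mul_le_mul_of_nonneg_right ha (norm_nonneg _)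
    _ = ‖b - 1‖ := one_mul _
    _ ≤ ρ := hb1

/-- **`Σ_{i<N} r^i r'^{N−1−i} = N + O(ρ)`** on the ball: for `‖r‖, ‖r'‖ ≤ 1` with
`‖r − 1‖, ‖r' − 1‖ ≤ ρ`, `‖Σ_{i<N} r^i r'^{N-1-i} − N‖ ≤ ρ`. [folklore] -/
theorem norm_geomSum₂_sub_natCast_le {r r' : ℂ_[p]} {ρ : ℝ} (hρ : 0 ≤ ρ) (hr : ‖r‖ ≤ 1)
    (hr' : ‖r'‖ ≤ 1) (hr1 : ‖r - 1‖ ≤ ρ) (hr'1 : ‖r' - 1‖ ≤ ρ) (N : ℕ) :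
    ‖(∑ i ∈ range N, r ^ i * r' ^ (N - 1 - i)) - N‖ ≤ ρ := by
  have h : (∑ i ∈ range N, r ^ i * r' ^ (N - 1 - i)) - (N : ℂ_[p]) =
      ∑ i ∈ range N, (r ^ i * r' ^ (N - 1 - i) - 1) := by
    rw [Finset.sum_sub_distrib, Finset.sum_const, Finset.card_range, nsmul_eq_mul, mul_one]
  rw [h]
  refine IsUltrametricDist.norm_sum_le_of_forall_le_of_nonneg hρ fun i _ ↦ ?_
  refine norm_mul_sub_one_le (by rw [norm_pow]; exact pow_le_one₀ (norm_nonneg _) hr) ?_ ?_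
  · exact (norm_pow_sub_one_le hr i).trans hr1
  · exact (norm_pow_sub_one_le hr' _).trans hr'1

/-! ### §2 Root extraction in `R₀` (Hensel / Newton for `X^N − y` at `1`) -/

/-- **Contraction estimate for the simplified Newton map** `T r = r − (r^N − y)/N`: on the ball
`‖· − 1‖ ≤ ρ` (inside `‖·‖ ≤ 1`), `‖T r − T r'‖ ≤ (ρ/‖N‖_p)·‖r − r'‖`, because
`T r − T r' = (r − r')(N − Σ_{i<N} r^i r'^{N-1-i})/N`. [cite: Serre1973, Ch. II §2.2] -/
theorem norm_newton_sub_newton_le {N : ℕ} (hN : N ≠ 0) (y : ℂ_[p]) {r r' : ℂ_[p]} {ρ : ℝ}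
    (hρ : 0 ≤ ρ) (hr : ‖r‖ ≤ 1) (hr' : ‖r'‖ ≤ 1) (hr1 : ‖r - 1‖ ≤ ρ) (hr'1 : ‖r' - 1‖ ≤ ρ) :
    ‖(r - (r ^ N - y) / N) - (r' - (r' ^ N - y) / N)‖ ≤ ρ / ‖(N : ℂ_[p])‖ * ‖r - r'‖ := by
  set H : ℂ_[p] := ∑ i ∈ range N, r ^ i * r' ^ (N - 1 - i) with hHdef
  have hn0 : (N : ℂ_[p]) ≠ 0 := Nat.cast_ne_zero.mpr hN
  have hH : H * (r - r') = r ^ N - r' ^ N := Commute.geom_sum₂_mul (Commute.all r r') N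
  have key : (r - (r ^ N - y) / N) - (r' - (r' ^ N - y) / N) = (r - r') * ((N - H) / N) := by
    have e1 : r ^ N = r' ^ N + H * (r - r') := by rw [hH]; ring
    rw [e1]
    field_simp
    ring
  rw [key, norm_mul, norm_div, mul_comm]
  refine mul_le_mul_of_nonneg_right ?_ (norm_nonneg _)
  refine div_le_div_of_nonneg_right ?_ (norm_nonneg _)
  rw [norm_sub_rev]
  exact norm_geomSum₂_sub_natCast_le hρ hr hr' hr1 hr'1 N

/-- **ROOT EXTRACTION in `R₀`.** For `N ≥ 1` and `y ∈ R₀` with `‖y − 1‖ < ‖N‖_p²` there is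
`r ∈ R₀` with `r^N = y` and `‖r − 1‖ ≤ ‖y − 1‖/‖N‖_p` (Newton iteration inside the complete set
`R₀ ∩ {‖r − 1‖ ≤ ‖y − 1‖/‖N‖_p}`; Banach fixed point). [cite: Serre1973, Ch. II §2.2] -/
theorem exists_pow_eq_of_norm_sub_one_lt {N : ℕ} (hN : N ≠ 0) {y : ℂ_[p]}
    (hy : y ∈ unrIntegers p) (hy1 : ‖y - 1‖ < ‖(N : ℂ_[p])‖ ^ 2) :
    ∃ r ∈ unrIntegers p, ‖r - 1‖ ≤ ‖y - 1‖ / ‖(N : ℂ_[p])‖ ∧ r ^ N = y := by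
  have hn0 : (N : ℂ_[p]) ≠ 0 := Nat.cast_ne_zero.mpr hN
  set ν : ℝ := ‖(N : ℂ_[p])‖ with hνdef
  have hν0 : 0 < ν := norm_natCast_pos hN
  have hν1 : ν ≤ 1 := norm_natCast_le_one N
  set ρ : ℝ := ‖y - 1‖ / ν with hρdef
  have hρ0 : 0 ≤ ρ := div_nonneg (norm_nonneg _) hν0.le
  have hρν : ρ < ν := by
    rw [hρdef, div_lt_iff₀ hν0, ← sq]; exact hy1
  have hρ1 : ρ ≤ 1 := (hρν.le).trans hν1
  -- the contraction ratio
  set c : ℝ := ρ / ν with hcdef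
  have hc0 : 0 ≤ c := div_nonneg hρ0 hν0.le
  have hc1 : c < 1 := (div_lt_one hν0).mpr hρν
  -- the Newton map and the invariant complete set
  set T : ℂ_[p] → ℂ_[p] := fun r ↦ r - (r ^ N - y) / N with hTdef
  set s : Set ℂ_[p] := {r | r ∈ unrIntegers p ∧ ‖r - 1‖ ≤ ρ} with hsdef
  have hs_norm : ∀ r ∈ s, ‖r‖ ≤ 1 := fun r hr ↦ Halves.norm_le_one_of_mem_unrIntegers p hr.1
  have h1s : (1 : ℂ_[p]) ∈ s := ⟨one_mem _, by rw [sub_self, norm_zero]; exact hρ0⟩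
  have hT1 : ‖T 1 - 1‖ = ρ := by
    simp only [hTdef, one_pow]
    rw [sub_sub_cancel_left, norm_neg, norm_div, norm_sub_rev]
  -- Lipschitz estimate on `s`
  have hLip : ∀ r ∈ s, ∀ r' ∈ s, ‖T r - T r'‖ ≤ c * ‖r - r'‖ := fun r hr r' hr' ↦
    norm_newton_sub_newton_le hN y hρ0 (hs_norm r hr) (hs_norm r' hr') hr.2 hr'.2
  -- `T` maps `s` into itself
  have hball : ∀ r ∈ s, ‖T r - 1‖ ≤ ρ := fun r hr ↦ by
    have h1 : ‖T r - T 1‖ ≤ ρ := by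
      refine (hLip r hr 1 h1s).trans ?_
      calc c * ‖r - 1‖ ≤ 1 * ρ := mul_le_mul hc1.le hr.2 (norm_nonneg _) zero_le_one
        _ = ρ := one_mul ρ
    have e : T r - 1 = (T r - T 1) + (T 1 - 1) := by abel
    rw [e]
    exact (IsUltrametricDist.norm_add_le_max _ _).trans (max_le h1 hT1.le)
  have hmaps : Set.MapsTo T s s := fun r hr ↦ by
    refine ⟨?_, hball r hr⟩
    -- `(r^N - y)/N ∈ R₀`: it lies in `Frac R₀` and has norm `≤ 1`
    have hw : (r ^ N - y) / N ∈ unrIntegers p := by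
      refine R1.mem_unrIntegers_of_mem_fracUnr ?_ ?_
      · exact div_mem (Subfield.subset_closure (sub_mem (pow_mem hr.1 N) hy))
          (Subfield.subset_closure (natCast_mem (unrIntegers p) N))
      · have e : (r ^ N - y) / N = (r - 1) - (T r - 1) := by simp only [hTdef]; abel
        rw [e, sub_eq_add_neg]
        refine (IsUltrametricDist.norm_add_le_max _ _).trans (max_le (hr.2.trans hρ1) ?_)
        rw [norm_neg]; exact (hball r hr).trans hρ1
    exact sub_mem hr.1 hw
  -- completeness of `s` and the fixed point
  have hsc : IsComplete s := by
    refine IsClosed.isComplete ?_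
    refine isClosed_unrIntegers.inter ?_
    exact isClosed_le (continuous_norm.comp (continuous_id.sub continuous_const)) continuous_const
  have hK : ContractingWith ⟨c, hc0⟩ (hmaps.restrict T s s) := by
    refine ⟨by exact_mod_cast hc1, LipschitzWith.of_dist_le_mul fun a b ↦ ?_⟩
    rw [Subtype.dist_eq, Subtype.dist_eq, dist_eq_norm, dist_eq_norm, Set.MapsTo.val_restrict_apply,
      Set.MapsTo.val_restrict_apply]
    exact hLip a a.2 b b.2
  obtain ⟨r, hrs, hfix, -⟩ := hK.exists_fixedPoint' hsc hmaps h1s (edist_ne_top _ _)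
  refine ⟨r, hrs.1, hrs.2, ?_⟩
  -- a fixed point of `T` is a root
  have hzero : (r ^ N - y) / N = 0 := by
    have h := hfix.eq
    simp only [hTdef] at h
    linear_combination (-1 : ℂ_[p]) * h
  rcases div_eq_zero_iff.mp hzero with h | h
  · exact sub_eq_zero.mp h
  · exact absurd h hn0

/-- The `N`-th root of §2 is a principal unit: `‖r − 1‖ < 1` (indeed `≤ ‖y − 1‖/‖N‖_p < ‖N‖_p`).
[cite: Serre1973, Ch. II §2.2] -/
theorem exists_pow_eq_of_norm_sub_one_lt' {N : ℕ} (hN : N ≠ 0) {y : ℂ_[p]}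
    (hy : y ∈ unrIntegers p) (hy1 : ‖y - 1‖ < ‖(N : ℂ_[p])‖ ^ 2) :
    ∃ r ∈ unrIntegers p, ‖r - 1‖ < 1 ∧ r ^ N = y := by
  obtain ⟨r, hr, hr1, hrN⟩ := exists_pow_eq_of_norm_sub_one_lt hN hy hy1
  refine ⟨r, hr, hr1.trans_lt ?_, hrN⟩
  have hν0 : 0 < ‖(N : ℂ_[p])‖ := norm_natCast_pos hN
  calc ‖y - 1‖ / ‖(N : ℂ_[p])‖ < ‖(N : ℂ_[p])‖ ^ 2 / ‖(N : ℂ_[p])‖ :=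
        div_lt_div_of_pos_right hy1 hν0
    _ = ‖(N : ℂ_[p])‖ := by rw [sq, mul_div_assoc, div_self hν0.ne', mul_one]
    _ ≤ 1 := norm_natCast_le_one N

/-! ### §3 Density of `ℤ[μ_{p'}]` in `R₀` and algebraicity of its elements -/

/-- **Density** (the definition of `unrIntegers` as a topological closure): every `k ∈ R₀` is
within any `ε > 0` of an element of `𝓐 = Subring.closure {ζ : ζ^m = 1, p ∤ m}`.
[cite: Castella2018, §3 (p. 9)] -/
theorem exists_mem_rootsSubring_norm_sub_lt {k : ℂ_[p]} (hk : k ∈ unrIntegers p) {ε : ℝ}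
    (hε : 0 < ε) :
    ∃ a ∈ Subring.closure {ζ : ℂ_[p] | ∃ m : ℕ, 0 < m ∧ ¬ p ∣ m ∧ ζ ^ m = 1}, ‖k - a‖ < ε := by
  have hk' : k ∈ closure ((Subring.closure
      {ζ : ℂ_[p] | ∃ m : ℕ, 0 < m ∧ ¬ p ∣ m ∧ ζ ^ m = 1} : Subring ℂ_[p]) : Set ℂ_[p]) := hk
  obtain ⟨a, ha, hd⟩ := Metric.mem_closure_iff.mp hk' ε hε
  exact ⟨a, ha, by rwa [← dist_eq_norm]⟩

/-- **Roots of unity of `ℂ_p` are algebraic**: if `ζ^m = 1` in `ℂ_p` (`m ≥ 1`) then `ζ` is the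
image of an element of `ℚ̄_p = PadicAlgCl p` (`X^m − 1` has `m` distinct roots in the
algebraically closed field `ℚ̄_p`, whose images are all its roots in the field `ℂ_p`). [folklore] -/
theorem exists_coe_eq_of_pow_eq_one {ζ : ℂ_[p]} {m : ℕ} (hm : 0 < m) (hζ : ζ ^ m = 1) :
    ∃ α : PadicAlgCl p, (α : ℂ_[p]) = ζ := by
  haveI : NeZero m := ⟨hm.ne'⟩
  obtain ⟨ζ₀, hζ₀⟩ := HasEnoughRootsOfUnity.exists_primitiveRoot (PadicAlgCl p) m
  have hζ₀' : IsPrimitiveRoot ((ζ₀ : PadicAlgCl p) : ℂ_[p]) m :=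
    hζ₀.map_of_injective (f := algebraMap (PadicAlgCl p) ℂ_[p])
      (algebraMap (PadicAlgCl p) ℂ_[p]).injective
  obtain ⟨i, -, hi⟩ := hζ₀'.eq_pow_of_pow_eq_one hζ
  refine ⟨ζ₀ ^ i, ?_⟩
  rw [PadicComplex.coe_eq, map_pow]
  exact hi

/-- **`ℤ[μ_{p'}] ⊆ ℚ̄_p`**: the subring of `ℂ_p` generated by the roots of unity of order prime to
`p` lies in the image of `PadicAlgCl p → ℂ_p`. [folklore] -/
theorem rootsSubring_le_range :
    Subring.closure {ζ : ℂ_[p] | ∃ m : ℕ, 0 < m ∧ ¬ p ∣ m ∧ ζ ^ m = 1} ≤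
      (algebraMap (PadicAlgCl p) ℂ_[p]).range := by
  refine Subring.closure_le.mpr ?_
  rintro ζ ⟨m, hm, -, hζ⟩
  obtain ⟨α, hα⟩ := exists_coe_eq_of_pow_eq_one hm hζ
  exact ⟨α, hα⟩

/-- Elements of `ℤ[μ_{p'}]` are in the range of the coercion `PadicAlgCl p → ℂ_p`. [folklore] -/
theorem mem_range_coe_of_mem_rootsSubring {a : ℂ_[p]}
    (ha : a ∈ Subring.closure {ζ : ℂ_[p] | ∃ m : ℕ, 0 < m ∧ ¬ p ∣ m ∧ ζ ^ m = 1}) :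
    a ∈ Set.range ((↑) : PadicAlgCl p → ℂ_[p]) := by
  obtain ⟨α, hα⟩ := rootsSubring_le_range ha
  exact ⟨α, hα⟩

/-! ### §4 The unit structure: `k = k₀ · r^N` with `k₀` algebraic -/

/-- **UNIT STRUCTURE of `R₀`** (`R₀ˣ = (ℤ[μ_{p'}] ∩ R₀ˣ) · (R₀ˣ)^N`): for `N ≥ 1` and `k ∈ R₀` with
`‖k‖ = 1` there are `k₀ ∈ ℤ[μ_{p'}]` (a polynomial in roots of unity of order prime to `p`, of norm
`1`) and a principal unit `r ∈ R₀` (`‖r − 1‖ < 1`) with `k = k₀ · r^N`. Proof: approximate `k` by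
`k₀` within `‖N‖_p²` (density, §3), so that `y = k k₀⁻¹ ∈ R₀` has `‖y − 1‖ < ‖N‖_p²`, and extract
the `N`-th root of `y` in `R₀` (§2). [cite: SerreLocalFields1979, Ch. IV §4 Prop. 16 and Cor. 2; Ch. XIV §4] -/
theorem exists_algebraic_mul_pow_eq {N : ℕ} (hN : N ≠ 0) {k : ℂ_[p]} (hk : k ∈ unrIntegers p)
    (hk1 : ‖k‖ = 1) :
    ∃ k₀ ∈ Subring.closure {ζ : ℂ_[p] | ∃ m : ℕ, 0 < m ∧ ¬ p ∣ m ∧ ζ ^ m = 1},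
      ∃ r ∈ unrIntegers p, ‖k₀‖ = 1 ∧ ‖r - 1‖ < 1 ∧ k = k₀ * r ^ N := by
  have hν0 : 0 < ‖(N : ℂ_[p])‖ := norm_natCast_pos hN
  have hν1 : ‖(N : ℂ_[p])‖ ≤ 1 := norm_natCast_le_one N
  obtain ⟨a, ha, hka⟩ := exists_mem_rootsSubring_norm_sub_lt hk (pow_pos hν0 2)
  have haR : a ∈ unrIntegers p := Subring.le_topologicalClosure _ ha
  have hν2 : ‖(N : ℂ_[p])‖ ^ 2 ≤ 1 := pow_le_one₀ (norm_nonneg _) hν1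
  have ha1 : ‖a‖ = 1 := by
    have h : ‖a - k‖ < ‖k‖ := by
      rw [norm_sub_rev, hk1]; exact hka.trans_le hν2
    rw [norm_eq_of_norm_sub_lt h, hk1]
  have ha0 : a ≠ 0 := fun h ↦ by
    rw [h, norm_zero] at ha1; exact zero_ne_one ha1
  have hainv : a⁻¹ ∈ unrIntegers p := unrIntegers.inv_mem_of_norm_eq_one haR ha1
  have hy : k * a⁻¹ ∈ unrIntegers p := mul_mem hk hainv
  have hy1 : ‖k * a⁻¹ - 1‖ < ‖(N : ℂ_[p])‖ ^ 2 := by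
    have e : k * a⁻¹ - 1 = (k - a) * a⁻¹ := by
      field_simp
    rw [e, norm_mul, norm_inv, ha1, inv_one, mul_one]
    exact hka
  obtain ⟨r, hr, hr1, hrN⟩ := exists_pow_eq_of_norm_sub_one_lt' hN hy hy1
  refine ⟨a, ha, r, hr, ha1, hr1, ?_⟩
  rw [hrN]
  field_simp

/-- **UNIT STRUCTURE of `R₀`, with `k₀` ALGEBRAIC** (r2's (P3) text): for `N ≥ 1` and `k ∈ R₀` with
`‖k‖ = 1`, `k = k₀ · r^N` with `k₀ ∈ R₀` of norm `1` IN THE RANGE OF `PadicAlgCl p → ℂ_p` and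
`r ∈ R₀` a principal unit. [cite: SerreLocalFields1979, Ch. IV §4 Prop. 16 and Cor. 2; Ch. XIV §4] -/
theorem exists_range_mul_pow_eq {N : ℕ} (hN : N ≠ 0) {k : ℂ_[p]} (hk : k ∈ unrIntegers p)
    (hk1 : ‖k‖ = 1) :
    ∃ k₀ r : ℂ_[p], k₀ ∈ Set.range ((↑) : PadicAlgCl p → ℂ_[p]) ∧ k₀ ∈ unrIntegers p ∧
      ‖k₀‖ = 1 ∧ r ∈ unrIntegers p ∧ ‖r - 1‖ < 1 ∧ ‖r‖ = 1 ∧ k = k₀ * r ^ N := by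
  obtain ⟨a, ha, r, hr, ha1, hr1, hkar⟩ := exists_algebraic_mul_pow_eq hN hk hk1
  exact ⟨a, r, mem_range_coe_of_mem_rootsSubring ha, Subring.le_topologicalClosure _ ha, ha1, hr,
    hr1, R1.norm_eq_one_of_norm_sub_one_lt hr1, hkar⟩

/-- **UNIT STRUCTURE of `R₀`, units-packaged**: every `k ∈ R₀ˣ` is `k₀ · r^N` in the group `R₀ˣ`
with `k₀` algebraic (indeed in `ℤ[μ_{p'}]`) and `r` a principal unit, for every `N ≥ 1`.
[cite: SerreLocalFields1979, Ch. IV §4 Prop. 16 and Cor. 2; Ch. XIV §4] -/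
theorem exists_algebraic_mul_pow {N : ℕ} (hN : 0 < N) (k : (unrIntegers p)ˣ) :
    ∃ k₀ r : (unrIntegers p)ˣ,
      ((k₀ : unrIntegers p) : ℂ_[p]) ∈ Set.range ((↑) : PadicAlgCl p → ℂ_[p]) ∧
      ((k₀ : unrIntegers p) : ℂ_[p]) ∈
        Subring.closure {ζ : ℂ_[p] | ∃ m : ℕ, 0 < m ∧ ¬ p ∣ m ∧ ζ ^ m = 1} ∧
      ‖((r : unrIntegers p) : ℂ_[p]) - 1‖ < 1 ∧ k = k₀ * r ^ N := by
  have hk1 : ‖((k : unrIntegers p) : ℂ_[p])‖ = 1 :=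
    (unrIntegers.isUnit_iff_norm_eq_one _).mp (Units.isUnit k)
  obtain ⟨a, ha, r, hr, ha1, hr1, hkar⟩ :=
    exists_algebraic_mul_pow_eq hN.ne' (k : unrIntegers p).2 hk1
  have haR : a ∈ unrIntegers p := Subring.le_topologicalClosure _ ha
  have hau : IsUnit (⟨a, haR⟩ : unrIntegers p) :=
    (unrIntegers.isUnit_iff_norm_eq_one _).mpr ha1
  have hru : IsUnit (⟨r, hr⟩ : unrIntegers p) :=
    (unrIntegers.isUnit_iff_norm_eq_one _).mpr (R1.norm_eq_one_of_norm_sub_one_lt hr1)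
  refine ⟨hau.unit, hru.unit, ?_, ?_, ?_, ?_⟩
  · rw [IsUnit.unit_spec]; exact mem_range_coe_of_mem_rootsSubring ha
  · rw [IsUnit.unit_spec]; exact ha
  · rw [IsUnit.unit_spec]; exact hr1
  · apply Units.ext
    apply Subtype.ext
    rw [Units.val_mul, Units.val_pow_eq_pow_val, IsUnit.unit_spec, IsUnit.unit_spec,
      Subring.coe_mul, Subring.coe_pow]
    exact hkar

/-! ### §5 The export shapes of record (route planner r2, typed `G6Shape` / `G6ShapeMin`) -/

/-- **G6, EXPORT SHAPE OF RECORD** (x11b3-r2's typed `G6Shape`, verbatim as a theorem): for `N ≥ 1`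
and a unit `k` of `R₀` there are an ALGEBRAIC `k₀ : PadicAlgCl p` — indeed in the subring generated
by the prime-to-`p` roots of unity, of norm `1` — and a unit `r` of `R₀` with `k = k₀ · r^N` in `ℂ_p`.
[cite: SerreLocalFields1979, Ch. IV §4 Prop. 16 and Cor. 2; Ch. XIV §4] -/
theorem exists_padicAlgCl_mul_unit_pow (N : ℕ) (hN : 0 < N) (k : (unrIntegers p)ˣ) :
    ∃ (k₀ : PadicAlgCl p) (r : (unrIntegers p)ˣ),
      (k₀ : ℂ_[p]) ∈ Subring.closure {ζ : ℂ_[p] | ∃ m : ℕ, 0 < m ∧ ¬ p ∣ m ∧ ζ ^ m = 1} ∧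
      ‖(k₀ : ℂ_[p])‖ = 1 ∧
      ((k : unrIntegers p) : ℂ_[p]) = (k₀ : ℂ_[p]) * ((r : unrIntegers p) : ℂ_[p]) ^ N := by
  obtain ⟨k₀, r, ⟨α, hα⟩, hk₀, -, hk⟩ := exists_algebraic_mul_pow hN k
  have h := congrArg (fun u : (unrIntegers p)ˣ ↦ ((u : unrIntegers p) : ℂ_[p])) hk
  simp only [Units.val_mul, Units.val_pow_eq_pow_val, Subring.coe_mul, Subring.coe_pow] at h
  refine ⟨α, r, ?_, ?_, ?_⟩
  · rw [hα]; exact hk₀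
  · rw [hα]; exact (unrIntegers.isUnit_iff_norm_eq_one _).mp (Units.isUnit k₀)
  · rw [hα]; exact h

/-- **G6, MINIMAL EXPORT SHAPE** (x11b3-r2's `G6ShapeMin`, the clause S29 K4-C consumes): for
`N ≥ 1` and a unit `k` of `R₀`, `k = k₀ · r^N` in `ℂ_p` with `k₀ : PadicAlgCl p` algebraic and `r` a
unit of `R₀`. [cite: SerreLocalFields1979, Ch. IV §4 Prop. 16 and Cor. 2; Ch. XIV §4] -/
theorem exists_padicAlgCl_mul_unit_pow_min (N : ℕ) (hN : 0 < N) (k : (unrIntegers p)ˣ) :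
    ∃ (k₀ : PadicAlgCl p) (r : (unrIntegers p)ˣ),
      ((k : unrIntegers p) : ℂ_[p]) = (k₀ : ℂ_[p]) * ((r : unrIntegers p) : ℂ_[p]) ^ N := by
  obtain ⟨k₀, r, -, -, hk⟩ := exists_padicAlgCl_mul_unit_pow N hN k
  exact ⟨k₀, r, hk⟩

/-- **T7 = G6 in the CONSUMER's unbundled currency** (x11b3-p7's K4-INTERFACES v4 §T7, verbatim:
"units of `R₀` are algebraic times `N`-th powers, ALL `N` incl. `p ∣ N`"): for `N ≥ 1` and
`u ∈ R₀` with `‖u‖ = 1` there are `α : PadicAlgCl p` and `r ∈ R₀` with `‖r‖ = 1` and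
`u = α · r^N`. [cite: SerreLocalFields1979, Ch. IV §4 Prop. 16 and Cor. 2; Ch. XIV §4] -/
theorem exists_padicAlgCl_mul_pow_of_norm_eq_one (N : ℕ) (hN : 0 < N) (u : ℂ_[p])
    (hu : u ∈ unrIntegers p) (hu1 : ‖u‖ = 1) :
    ∃ (α : PadicAlgCl p) (r : ℂ_[p]), r ∈ unrIntegers p ∧ ‖r‖ = 1 ∧ u = (α : ℂ_[p]) * r ^ N := by
  obtain ⟨k₀, r, ⟨α, hα⟩, -, -, hr, -, hr1, hk⟩ := exists_range_mul_pow_eq hN.ne' hu hu1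
  exact ⟨α, r, hr, hr1, by rw [hα]; exact hk⟩

/-- T7 in its quantified form of record (x11b3-p7's text, verbatim). [folklore] -/
theorem forall_exists_padicAlgCl_mul_pow_of_norm_eq_one :
    ∀ N : ℕ, 0 < N → ∀ u : ℂ_[p], u ∈ unrIntegers p → ‖u‖ = 1 →
      ∃ (α : PadicAlgCl p) (r : ℂ_[p]), r ∈ unrIntegers p ∧ ‖r‖ = 1 ∧ u = (α : ℂ_[p]) * r ^ N :=
  fun N hN u hu hu1 ↦ exists_padicAlgCl_mul_pow_of_norm_eq_one N hN u hu hu1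

end UnrUnits

end Summit.BirchSwinnertonDyer.Rank1Residual.X11b
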